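import Summits.HodgeConjecture.HodgeConjecture.Theorems.F0P3cU2PrincipalSeriesJacquetFiltration   -- ★-to-be W2-c `u2PrincipalSeries_jacquetFiltration`
import Literature.NumberTheory.Automorphic.JacquetRayShellAllLevels                              -- ★ LH10-p02 F1-G `smoothTrace_indicator_shell_eq_ite_of_normalizedTwoStep`, `trace_eq_add_of_line_of_sub_mem`
import Literature.NumberTheory.Automorphic.JacquetRayExponents                                  -- ★ `jacquetModule_apply_eq_smul_of_normalizedJacquet`, `normalizedJacquet_apply`
import Literature.NumberTheory.Automorphic.SmoothInductionAdmissibleOfCocompact                 -- ★ `isAdmissible_cmPrincipalSeries_of_iwasawa`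
import Literature.NumberTheory.Automorphic.UnitaryGroupCMLocalIwasawa                           -- ★ `exists_borel_mul_mem_cmLocalIntegralLevel`
import HarnessLib

/-!
# The character of `i(χ₁, χ₂)` on `U(Φ₂)(L⁺_v)` on the shells `K_n b K_n`: the Jacquet trace `tr (i χ)_N(t) = δ_{B₂}^{1∕2}(t)(χ(t) + wχ(t))` (deep level, the
# `(hfd, s, hs)` datum of ★ `F0P3cStCharTSCassHTrace.steinbergLabel_smoothTrace_shell_eq`) and the ALL-LEVEL value (F1-H, through ★ F1-G)

Summit `HodgeConjecture`, sub-problem `HodgeConjecture`, crux H413 (`stmt-HodgeConjecture-24833`, lane `--supports … --as helper`); cell `hodgecm-mathlib`,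
line LH6 «StCharTS», road (D) «DEEP-FL» slice (D-b)∕F1-H, brick W2-d (seat LH5-p05 (g2)).  THEOREMS ONLY; no definition, no instance, no notation, no named fact,
no `sorry`.  HONEST LABEL: count-neutral; HC_CM is proved only modulo the 7 printed citations (2 remaining: hLiu418 = stmt-HodgeConjecture-24832, h413 =
stmt-HodgeConjecture-24833) until rung 0 closes.

* §1 `u2PrincipalSeries_jacquet_trace` — from the filtration ★ `u2PrincipalSeries_jacquetFiltration` (dim 2, line `wχ`, quotient `χ`, NORMALISED action): the UNNORMALISED
  Jacquet module `(i χ)_N` has `tr (i χ)_N(t) = δ_{B₂}^{1∕2}(t)·wχ(t) + δ_{B₂}^{1∕2}(t)·χ(t)` (★ `trace_eq_add_of_line_of_sub_mem`, ★ `jacquetModule_apply_eq_smul_of_normalizedJacquet`);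
  `u2PrincipalSeries_jacquet_trace_multiset` — the same as the multiset datum `s = {δ^{1∕2}wχ, δ^{1∕2}χ}` of ★ `F0P3cStCharTSShellKit.smoothTrace_shell_eq_mul_sum` ∕ ★
  `F0P3cStCharTSCassHTrace.steinbergLabel_smoothTrace_shell_eq` (discharging that slice's Jacquet-datum binder at deep level).
* §2 `smoothTrace_cmPrincipalSeries_two_shell_eq_ite` — AT EVERY LEVEL of an Iwahori datum `𝓘₂` of `B₂` (binder) whose level-`n` trace on the torus is `w`-symmetric for the
  character (`hiff : χ|_{K_n ∩ T₂} = 1 ↔ wχ|_{K_n ∩ T₂} = 1`), for a dominant central `b ∈ T₂`: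
  `tr i(χ)(𝟙_{K_n b K_n}; ν) = ν(K_n)·#R·(if χ|_{K_n ∩ T₂} = 1 then δ_{B₂}^{1∕2}(b)·(χ(b) + wχ(b)) else 0)` — ★ F1-G `smoothTrace_indicator_shell_eq_ite_of_normalizedTwoStep` at the
  filtration of §1 [Casselman1977, Thm. 5.2; Rogawski1990, §12.7 p. 193 «by Casselman's theorem χ_π(γ) = χ_{π_N}(γ)»].

## References
* [Casselman1977] W. Casselman, *Characters and Jacquet modules*, Math. Ann. 230 (1977) 101–105, Thm. 5.2.
* [Casselman1995] W. Casselman, *Introduction to the theory of admissible representations of `p`-adic reductive groups* (1995), Lemma 7.1.1 (a), Thm. 3.3.3, Prop. 4.1.6.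
* [Rogawski1990] J. D. Rogawski, *Automorphic Representations of Unitary Groups in Three Variables* (1990), §12.1 p. 171, §12.7 p. 193.
-/

set_option autoImplicit false
set_option linter.dupNamespace false

noncomputable section

open MeasureTheory
open scoped Pointwise MatrixGroups
open Literature.NumberTheory.Automorphic Literature.NumberTheory.Automorphic.UnitaryGroup
open _root_.NumberField _root_.IsDedekindDomain

-- the mandated namespace has the single-problem summit's repeated segment (`HodgeConjecture.HodgeConjecture`)
namespace Summit.HodgeConjecture.HodgeConjecture.Cruxes.H413.F0P3cU2PrincipalSeriesShellTrace

variable (L : Type) [Field L] [NumberField L] [IsCMField L]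

/-! ## §0 Generic: the trace of the unnormalised Jacquet module from a normalised 2-step filtration -/

/-- **`tr ρ_N(m) = δ_P^{1∕2}(m)χa(m) + δ_P^{1∕2}(m)χb(m)`** for a representation `ρ` whose NORMALISED Jacquet module `r_P(ρ) = ρ_N ⊗ δ_P^{-1∕2}` is two-dimensional
with an `M`-line `ℓ` of character `χa` and quotient character `χb` (un-normalise by ★ `jacquetModule_apply_eq_smul_of_normalizedJacquet` ∕ ★ `normalizedJacquet_apply`, then ★
`Representation.trace_eq_add_of_line_of_sub_mem`; the computation inside ★ `smoothTrace_indicator_shell_eq_ite_of_normalizedTwoStep`, exported). [cite: Casselman1995, Thm. 3.3.3, Lemma 7.1.1 (a)]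
[cite: BernsteinZelevinsky1977, §2.3] -/
theorem trace_jacquetModule_eq_of_normalizedTwoStep {G : Type*} [Group G] [TopologicalSpace G] [IsTopologicalGroup G]
    (t : ParabolicTriple G) [LocallyCompactSpace ↥t.P] {V : Type*} [AddCommGroup V] [Module ℂ V] (ρ : Representation ℂ G V)
    [FiniteDimensional ℂ (t.restrict ρ).Coinvariants] (h2 : Module.finrank ℂ (t.restrict ρ).Coinvariants = 2)
    (ℓ : Submodule ℂ (t.restrict ρ).Coinvariants) (hℓ1 : Module.finrank ℂ ℓ = 1) (χa χb : ↥t.M →* ℂˣ)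
    (hL : ∀ (m : ↥t.M), ∀ x ∈ ℓ, ρ.normalizedJacquet t m x = ((χa m : ℂˣ) : ℂ) • x)
    (hQ : ∀ (m : ↥t.M) (x : (t.restrict ρ).Coinvariants), ρ.normalizedJacquet t m x - ((χb m : ℂˣ) : ℂ) • x ∈ ℓ) (m : ↥t.M) :
    LinearMap.trace ℂ _ (ρ.jacquetModule t m) =
      (((((rootDeltaChar t.P).comp (Subgroup.inclusion t.M_le)) * χa) m : ℂˣ) : ℂ) + (((((rootDeltaChar t.P).comp (Subgroup.inclusion t.M_le)) * χb) m : ℂˣ) : ℂ) := by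
  have hL' : ∀ x ∈ ℓ, ρ.jacquetModule t m x = (((((rootDeltaChar t.P).comp (Subgroup.inclusion t.M_le)) * χa) m : ℂˣ) : ℂ) • x := by
    intro x hx
    rw [Representation.jacquetModule_apply_eq_smul_of_normalizedJacquet t (fun m' => hL m' x hx) m, MonoidHom.mul_apply, MonoidHom.comp_apply, Units.val_mul]
  have hQ' : ∀ x : (t.restrict ρ).Coinvariants, ρ.jacquetModule t m x - (((((rootDeltaChar t.P).comp (Subgroup.inclusion t.M_le)) * χb) m : ℂˣ) : ℂ) • x ∈ ℓ := by
    intro x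
    have h := ℓ.smul_mem (((rootDeltaChar t.P (Subgroup.inclusion t.M_le m)) : ℂˣ) : ℂ) (hQ m x)
    rw [smul_sub, Representation.normalizedJacquet_apply, smul_smul, Units.mul_inv, one_smul, smul_smul] at h
    rw [MonoidHom.mul_apply, MonoidHom.comp_apply, Units.val_mul]
    exact h
  exact Representation.trace_eq_add_of_line_of_sub_mem _ h2 ℓ hℓ1 _ _ hL' hQ'

/-! ## §1 The Jacquet trace of `i(χ₁, χ₂)` on `U(Φ₂)(L⁺_v)` -/

set_option synthInstance.maxHeartbeats 400000 in
set_option maxHeartbeats 8000000 in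
/-- **`tr (i χ)_N(t) = δ_{B₂}^{1∕2}(t)·wχ(t) + δ_{B₂}^{1∕2}(t)·χ(t)`** on the (unnormalised) Jacquet module of `i(χ₁, χ₂) = cmPrincipalSeries L 2 v χ`, `v` NON-SPLIT, `χ₁, χ₂`
continuous (with the Jacquet module finite-dimensional): the filtration ★ `u2PrincipalSeries_jacquetFiltration` un-normalised.
[cite: Casselman1995, Lemma 7.1.1 (a), Thm. 3.3.3] [cite: Rogawski1990, §12.1 p. 171] -/
theorem u2PrincipalSeries_jacquet_trace (v : HeightOneSpectrum (𝓞 ↥(maximalRealSubfield L)))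
    (hns : ∀ w : PlacesOver L v, IsCMField.complexConj L • w.1 = w.1)
    (χ₁ : (LocalRing L v)ˣ →* ℂˣ) (χ₂ : ↥(normOneUnits (conjLocal L (IsCMField.complexConj L) v)) →* ℂˣ)
    (h₁ : Continuous fun x => ((χ₁ x : ℂˣ) : ℂ)) (h₂ : Continuous fun x => ((χ₂ x : ℂˣ) : ℂ)) :
    haveI := locallyCompactSpace_cmBorelU L 2 v
    FiniteDimensional ℂ ((cmBorelTriple L 2 v).restrict (cmPrincipalSeries L 2 v
        (torusCharPair (conjLocal L (IsCMField.complexConj L) v) (cmLocalForm L 2 v) (cmLocalForm_eq_over L 2 v) 0 χ₁ χ₂))).Coinvariants ∧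
    ∀ m : ↥(cmBorelTriple L 2 v).M, LinearMap.trace ℂ _
        ((cmPrincipalSeries L 2 v (torusCharPair (conjLocal L (IsCMField.complexConj L) v) (cmLocalForm L 2 v) (cmLocalForm_eq_over L 2 v) 0 χ₁ χ₂)).jacquetModule
          (cmBorelTriple L 2 v) m) =
      ((((rootDeltaChar (cmBorelTriple L 2 v).P).comp (Subgroup.inclusion (cmBorelTriple L 2 v).M_le) *
          weylTorusCharPair (conjLocal L (IsCMField.complexConj L) v) (cmLocalForm L 2 v) (cmLocalForm_eq_over L 2 v) 0 χ₁ χ₂) m : ℂˣ) : ℂ) +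
      ((((rootDeltaChar (cmBorelTriple L 2 v).P).comp (Subgroup.inclusion (cmBorelTriple L 2 v).M_le) *
          torusCharPair (conjLocal L (IsCMField.complexConj L) v) (cmLocalForm L 2 v) (cmLocalForm_eq_over L 2 v) 0 χ₁ χ₂) m : ℂˣ) : ℂ) := by
  haveI := locallyCompactSpace_cmBorelU L 2 v
  have H := F0P3cU2PrincipalSeriesJacquetFiltration.u2PrincipalSeries_jacquetFiltration L v hns χ₁ χ₂ h₁ h₂
  obtain ⟨hfd, h2, ℓ, hℓ1, hL, hQ⟩ := H
  haveI := hfd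
  exact ⟨hfd, fun m => trace_jacquetModule_eq_of_normalizedTwoStep (cmBorelTriple L 2 v) _ h2 ℓ hℓ1 _ _ hL hQ m⟩

set_option synthInstance.maxHeartbeats 400000 in
set_option maxHeartbeats 8000000 in
/-- **The Jacquet datum of `i(χ₁, χ₂)` on `U(Φ₂)(L⁺_v)` in MULTISET form** — the `(hfd, s, hs)` binder of ★ `F0P3cStCharTSCassHTrace.steinbergLabel_smoothTrace_shell_eq`
(and of ★ `F0P3cStCharTSShellKit.smoothTrace_shell_eq_mul_sum`) DISCHARGED with `s = {δ_{B₂}^{1∕2}·wχ, δ_{B₂}^{1∕2}·χ}` (`v` non-split, `χ₁, χ₂` continuous).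
[cite: Casselman1995, Lemma 7.1.1 (a)] [cite: Rogawski1990, §12.1 p. 171; §12.7 p. 193] -/
theorem u2PrincipalSeries_jacquet_trace_multiset (v : HeightOneSpectrum (𝓞 ↥(maximalRealSubfield L)))
    (hns : ∀ w : PlacesOver L v, IsCMField.complexConj L • w.1 = w.1)
    (χ₁ : (LocalRing L v)ˣ →* ℂˣ) (χ₂ : ↥(normOneUnits (conjLocal L (IsCMField.complexConj L) v)) →* ℂˣ)
    (h₁ : Continuous fun x => ((χ₁ x : ℂˣ) : ℂ)) (h₂ : Continuous fun x => ((χ₂ x : ℂˣ) : ℂ)) :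
    haveI := locallyCompactSpace_cmBorelU L 2 v
    FiniteDimensional ℂ ((cmBorelTriple L 2 v).restrict (cmPrincipalSeries L 2 v
        (torusCharPair (conjLocal L (IsCMField.complexConj L) v) (cmLocalForm L 2 v) (cmLocalForm_eq_over L 2 v) 0 χ₁ χ₂))).Coinvariants ∧
    ∀ m : ↥(cmBorelTriple L 2 v).M, LinearMap.trace ℂ _
        ((cmPrincipalSeries L 2 v (torusCharPair (conjLocal L (IsCMField.complexConj L) v) (cmLocalForm L 2 v) (cmLocalForm_eq_over L 2 v) 0 χ₁ χ₂)).jacquetModule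
          (cmBorelTriple L 2 v) m) =
      (({(rootDeltaChar (cmBorelTriple L 2 v).P).comp (Subgroup.inclusion (cmBorelTriple L 2 v).M_le) *
            weylTorusCharPair (conjLocal L (IsCMField.complexConj L) v) (cmLocalForm L 2 v) (cmLocalForm_eq_over L 2 v) 0 χ₁ χ₂,
          (rootDeltaChar (cmBorelTriple L 2 v).P).comp (Subgroup.inclusion (cmBorelTriple L 2 v).M_le) *
            torusCharPair (conjLocal L (IsCMField.complexConj L) v) (cmLocalForm L 2 v) (cmLocalForm_eq_over L 2 v) 0 χ₁ χ₂} :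
          Multiset (↥(cmBorelTriple L 2 v).M →* ℂˣ)).map fun θ : ↥(cmBorelTriple L 2 v).M →* ℂˣ => ((θ m : ℂˣ) : ℂ)).sum := by
  have H := u2PrincipalSeries_jacquet_trace L v hns χ₁ χ₂ h₁ h₂
  refine ⟨H.1, fun m => ?_⟩
  rw [H.2 m, Multiset.insert_eq_cons, Multiset.map_cons, Multiset.map_singleton, Multiset.sum_cons, Multiset.sum_singleton]

/-! ## §2 The character on the shells `K_n b K_n` at every level (F1-H) -/

open scoped Classical in
set_option synthInstance.maxHeartbeats 400000 in
set_option maxHeartbeats 8000000 in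
/-- **F1-H — THE CHARACTER OF `i(χ₁, χ₂)` ON `U(Φ₂)(L⁺_v)` ON THE SHELLS `K_n b K_n` AT EVERY LEVEL**: `v` non-split, `χ₁, χ₂` continuous, `ν` a left-invariant measure
finite on compacts, `𝓘₂` an Iwahori datum of `B₂` (binder), `n` a level at which `χ|_{K_n ∩ T₂} = 1 ↔ wχ|_{K_n ∩ T₂} = 1` (`hiff`; automatic for `w₀`-stable levels),
`b ∈ T₂` commuting with `T₂` and dominant at level `n` (binder shapes of ★ R2d), `R` a left transversal of `K_n ∕ (K_n ∩ bK_nb⁻¹)`: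
`tr i(χ)(𝟙_{K_n b K_n}; ν) = ν(K_n)·#R·(if χ|_{K_n ∩ T₂} = 1 then δ_{B₂}^{1∕2}(b)·(χ(b) + wχ(b)) else 0)` — ★ F1-G `smoothTrace_indicator_shell_eq_ite_of_normalizedTwoStep`
at the filtration ★ `u2PrincipalSeries_jacquetFiltration`. [cite: Casselman1977, Thm. 5.2] [cite: Casselman1995, Lemma 7.1.1 (a), Prop. 4.1.6] [cite: Rogawski1990, §12.7 p. 193] -/
theorem smoothTrace_cmPrincipalSeries_two_shell_eq_ite (v : HeightOneSpectrum (𝓞 ↥(maximalRealSubfield L)))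
    (hns : ∀ w : PlacesOver L v, IsCMField.complexConj L • w.1 = w.1)
    (χ₁ : (LocalRing L v)ˣ →* ℂˣ) (χ₂ : ↥(normOneUnits (conjLocal L (IsCMField.complexConj L) v)) →* ℂˣ)
    (h₁ : Continuous fun x => ((χ₁ x : ℂˣ) : ℂ)) (h₂ : Continuous fun x => ((χ₂ x : ℂˣ) : ℂ))
    [MeasurableSpace ↥(unitaryGroupOfForm (conjLocal L (IsCMField.complexConj L) v) (cmLocalForm L 2 v))]
    [BorelSpace ↥(unitaryGroupOfForm (conjLocal L (IsCMField.complexConj L) v) (cmLocalForm L 2 v))]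
    (ν : Measure ↥(unitaryGroupOfForm (conjLocal L (IsCMField.complexConj L) v) (cmLocalForm L 2 v))) [ν.IsMulLeftInvariant] [IsFiniteMeasureOnCompacts ν]
    (𝓘 : (cmBorelTriple L 2 v).IwahoriDatum) (n : ℕ)
    (hiff : (∀ k : ↥(cmBorelTriple L 2 v).M, (k : ↥(unitaryGroupOfForm (conjLocal L (IsCMField.complexConj L) v) (cmLocalForm L 2 v))) ∈ 𝓘.K n →
        torusCharPair (conjLocal L (IsCMField.complexConj L) v) (cmLocalForm L 2 v) (cmLocalForm_eq_over L 2 v) 0 χ₁ χ₂ k = 1) ↔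
      (∀ k : ↥(cmBorelTriple L 2 v).M, (k : ↥(unitaryGroupOfForm (conjLocal L (IsCMField.complexConj L) v) (cmLocalForm L 2 v))) ∈ 𝓘.K n →
        weylTorusCharPair (conjLocal L (IsCMField.complexConj L) v) (cmLocalForm L 2 v) (cmLocalForm_eq_over L 2 v) 0 χ₁ χ₂ k = 1))
    {b : ↥(unitaryGroupOfForm (conjLocal L (IsCMField.complexConj L) v) (cmLocalForm L 2 v))} (hbM : b ∈ (cmBorelTriple L 2 v).M)
    (hbcomm : ∀ m ∈ (cmBorelTriple L 2 v).M, m * b = b * m) (hbN : ∀ x ∈ 𝓘.K n ⊓ (cmBorelTriple L 2 v).N, b * x * b⁻¹ ∈ 𝓘.K n)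
    (hbNbar : ∀ x ∈ 𝓘.K n ⊓ 𝓘.Nbar, b⁻¹ * x * b ∈ 𝓘.K n ⊓ 𝓘.Nbar)
    (hbexh : ∀ x ∈ (cmBorelTriple L 2 v).N, ∃ m : ℕ, ∀ m', m ≤ m' → b ^ m' * x * (b ^ m')⁻¹ ∈ 𝓘.K n)
    {R : Finset ↥(unitaryGroupOfForm (conjLocal L (IsCMField.complexConj L) v) (cmLocalForm L 2 v))}
    (hR : IsLeftTransversal (𝓘.K n) (𝓘.K n ⊓ ConjAct.toConjAct b • 𝓘.K n) R) :
    haveI := locallyCompactSpace_cmBorelU L 2 v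
    (cmPrincipalSeries L 2 v (torusCharPair (conjLocal L (IsCMField.complexConj L) v) (cmLocalForm L 2 v) (cmLocalForm_eq_over L 2 v) 0 χ₁ χ₂)).smoothTrace ν
        ((DoubleCoset.doubleCoset b (𝓘.K n : Set ↥(unitaryGroupOfForm (conjLocal L (IsCMField.complexConj L) v) (cmLocalForm L 2 v))) (𝓘.K n)).indicator
          fun _ => (1 : ℂ)) =
      (ν.real (𝓘.K n : Set ↥(unitaryGroupOfForm (conjLocal L (IsCMField.complexConj L) v) (cmLocalForm L 2 v))) : ℂ) * (R.card : ℂ) *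
        (if (∀ k : ↥(cmBorelTriple L 2 v).M, (k : ↥(unitaryGroupOfForm (conjLocal L (IsCMField.complexConj L) v) (cmLocalForm L 2 v))) ∈ 𝓘.K n →
            torusCharPair (conjLocal L (IsCMField.complexConj L) v) (cmLocalForm L 2 v) (cmLocalForm_eq_over L 2 v) 0 χ₁ χ₂ k = 1) then
          ((rootDeltaChar (cmBorelTriple L 2 v).P (Subgroup.inclusion (cmBorelTriple L 2 v).M_le ⟨b, hbM⟩) : ℂˣ) : ℂ) *
            ((((torusCharPair (conjLocal L (IsCMField.complexConj L) v) (cmLocalForm L 2 v) (cmLocalForm_eq_over L 2 v) 0 χ₁ χ₂) ⟨b, hbM⟩ : ℂˣ) : ℂ) +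
              (((weylTorusCharPair (conjLocal L (IsCMField.complexConj L) v) (cmLocalForm L 2 v) (cmLocalForm_eq_over L 2 v) 0 χ₁ χ₂) ⟨b, hbM⟩ : ℂˣ) : ℂ))
        else 0) := by
  haveI := locallyCompactSpace_cmBorelU L 2 v
  have H := F0P3cU2PrincipalSeriesJacquetFiltration.u2PrincipalSeries_jacquetFiltration L v hns χ₁ χ₂ h₁ h₂
  obtain ⟨hfd, h2, ℓ, hℓ1, hL, hQ⟩ := H
  have hadm : (cmPrincipalSeries L 2 v (torusCharPair (conjLocal L (IsCMField.complexConj L) v) (cmLocalForm L 2 v) (cmLocalForm_eq_over L 2 v) 0 χ₁ χ₂)).IsAdmissible :=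
    isAdmissible_cmPrincipalSeries_of_iwasawa L 2 v (exists_borel_mul_mem_cmLocalIntegralLevel L 2 v) _
  have hP : IsClosed (((cmBorelTriple L 2 v).P : Subgroup ↥(unitaryGroupOfForm (conjLocal L (IsCMField.complexConj L) v) (cmLocalForm L 2 v))) :
      Set ↥(unitaryGroupOfForm (conjLocal L (IsCMField.complexConj L) v) (cmLocalForm L 2 v))) :=
    isClosed_borelU (conjLocal L (IsCMField.complexConj L) v) (cmLocalForm L 2 v)
  have hN : IsClosed (((cmBorelTriple L 2 v).N : Subgroup ↥(unitaryGroupOfForm (conjLocal L (IsCMField.complexConj L) v) (cmLocalForm L 2 v))) :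
      Set ↥(unitaryGroupOfForm (conjLocal L (IsCMField.complexConj L) v) (cmLocalForm L 2 v))) :=
    (isClosed_upperUnitriangular (n := 2) (R := LocalRing L v)).preimage continuous_subtype_val
  exact Representation.smoothTrace_indicator_shell_eq_ite_of_normalizedTwoStep ν hadm (cmBorelTriple L 2 v) hP hN 𝓘 n hfd h2 ℓ hℓ1 _ _ hL hQ hiff
    hbM hbcomm hbN hbNbar hbexh hR

end Summit.HodgeConjecture.HodgeConjecture.Cruxes.H413.F0P3cU2PrincipalSeriesShellTrace

end
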